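import Summits.QuantumAdvantage.QuantumAdvantage.Theses.CompactnessLift
import Summits.QuantumAdvantage.QuantumAdvantage.Theorems.CompactnessLiftLanguageLadderSummitStrength
import Literature.Computability.QuantumComplexity.OracleSeparationsProofs
import Literature.Computability.QuantumComplexity.BQPRelLog
import Literature.Computability.QuantumComplexity.SimUniformity
import Literature.Computability.Complexity.OracleEmpty
import Literature.Computability.Complexity.OracleProofs
import Literature.Computability.Complexity.PolyHierarchyProofs
import HarnessLib

/-!
# `LanguageLadder` — ladder-down in the crux's own language: typed rungs, compiled floor, cliffs

Forward generator G4 (`ladder-down`, unit `fwd-ladder-QuantumAdvantage-51`) on the ladder TOP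
`Summit.QuantumAdvantage.QuantumAdvantage.Theses.CompactnessLift.LanguageLadder`
(item `stmt-QuantumAdvantage-15271`; top equivalence landed:
`Theorems.CompactnessLiftLanguageLadder.languageLadder_iff_not_BQTime_two_subset_BPP`,
`quantumAdvantage_of_languageLadder`).

The crux reads "for every classical exponent `c` some language of `BQTIME(n²)` (quadratic-time
uniform, oracle-free Clifford+T, oracle `0`) lies outside `BP·DTIME(n^c)`". Its gradation
parameters, each typed below as a family of `Prop`s over EXISTING declarations:

* `MRung 𝒬` — the machine-class / quantum-exponent axis: `∀ c, ∃ L ∈ 𝒬, L ∉ BPTime(n^c)`.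
  `MRung (BQTime (·^2)) = LanguageLadderR` (item 18127, `Iff.rfl`), `MRung BQP = W`,
  `MRung PP` is Vinodchandran 2005 / Aaronson 2006 in print.
* `CRung c` — the classical-exponent axis at fixed quantum exponent `2` (one rung of 18127).
* `OracleRung 𝒞` — the oracle axis: `∃ A ∈ 𝒞, BQP^A ⊄ BPP^A`; floor `𝒞 = univ` is the TREE
  theorem `exists_oracle_BQPRel_not_subset_BPPRel_holds` (Raz–Tal chain, switching lemma).
* `QueryRung t` — the query-budget axis: `∃ A, BQP^{A[t]} ⊄ BPP^A` (`BQPRelQueries`).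

CLIFF LEMMAS (all sorry-free): the first rung below the crux on every axis is, modulo the
summit `S = QuantumAdvantage` itself, a CLASSICAL statement —
`w_iff_hier_or_summit : MRung BQP ↔ Hier ∨ S` (`Hier` = the advice-free BPTIME hierarchy in
language form, open: Barak 2002, Fortnow–Santhanam 2004), `cRung_imp : CRung c → HierAt c ∨ S`,
`oracleRung_cap : (BPP low for BQP) → 𝒞 ⊆ BPP → OracleRung 𝒞 → S` (so `OracleRung EXP`
forces `EXP ⊄ BPP ∨ S`), `queryRung_zero_iff : QueryRung 0 ↔ S` (the query axis is a cliff: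
one query is the print floor, zero queries is the summit). On-path directions `S → rung` are
proved for every family (`summit_imp_w`, `summit_imp_oracleRung`, `summit_imp_queryRung`).

References: [BernsteinVazirani1997SICOMP] §8.4; [RazTalJACM2022] Cor. 1.5; [AaronsonAmbainis2014]
§3; [BennettBernsteinBrassardVazirani1997] Cor. 4.15 (`BQP^BQP = BQP`, used only as a HYPOTHESIS
`hlow`); L. Fortnow, R. Santhanam, *Hierarchy theorems for probabilistic polynomial time*, FOCS
2004; B. Barak, *A probabilistic-time hierarchy theorem for slightly non-uniform algorithms*,
RANDOM 2002; N. V. Vinodchandran, *A note on the circuit complexity of PP*, TCS 347 (2005);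
S. Aaronson, *Oracles are subtle but not malicious*, CCC 2006.
-/

set_option linter.dupNamespace false

namespace Summit.QuantumAdvantage.QuantumAdvantage.Cruxes.LanguageLadder.LadderCliffs

open Literature.Computability.Complexity Literature.Computability.Cryptography
  Literature.Computability.QuantumComplexity
open Summit.QuantumAdvantage.QuantumAdvantage.Theses.CompactnessLift
open Summit.QuantumAdvantage.QuantumAdvantage.Theorems.CompactnessLiftLanguageLadder

/-! ### The rung families (gradation parameters of `LanguageLadder` in its own language) -/

/-- Machine-class axis: for every classical exponent `c`, some language of the class `𝒬` lies
outside honest `BPTIME(n^c)`. `𝒬 = BQTime(n²)` is `LanguageLadderR`; `𝒬 = BQP` is `W`. -/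
def MRung (𝒬 : Set (Language Bool)) : Prop :=
  ∀ c : ℕ, ∃ L ∈ 𝒬, L ∉ BPTime (fun n => n ^ c)

/-- The advice-free probabilistic time hierarchy at level `c`, language form: `BPP ⊄ BPTIME(n^c)`.
Open for every `c ≥ 1` (Barak 2002; Fortnow–Santhanam 2004: known only with one advice bit). -/
def HierAt (c : ℕ) : Prop :=
  ¬ (BPP ⊆ BPTime (fun n => n ^ c))

/-- The advice-free probabilistic time hierarchy, all levels. -/
def Hier : Prop :=
  ∀ c : ℕ, HierAt c

/-- Classical-exponent axis at quantum exponent `2`: rung `c` of `LanguageLadderR`. -/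
def CRung (c : ℕ) : Prop :=
  ∃ L ∈ BQTime (fun n => n ^ 2), L ∉ BPTime (fun n => n ^ c)

/-- Oracle axis: some oracle of the class `𝒞` separates `BQP^A` from `BPP^A`. -/
def OracleRung (𝒞 : Set (Language Bool)) : Prop :=
  ∃ A ∈ 𝒞, ¬ (BQPRel A ⊆ BPPRel (Oracle.ofLanguage A))

/-- Query-budget axis: some oracle separates the `t(n)`-query class `BQP^{A[t]}`
(`BQPRelQueries A t`) from `BPP^A`. -/
def QueryRung (t : ℕ → ℕ) : Prop :=
  ∃ A : Language Bool, ¬ (BQPRelQueries A t ⊆ BPPRel (Oracle.ofLanguage A))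

/-! ### Bookkeeping -/

/-- The summit is `BQP ⊄ BPP`. -/
theorem summit_iff_not_subset : _root_.QuantumAdvantage ↔ ¬ (BQP ⊆ BPP) := by
  unfold _root_.QuantumAdvantage Literature.QuantumAdvantage.BQPNotSubsetBPP
  exact Set.not_subset.symm

/-- `BPP ⊆ BPP^O` for every oracle (`P ⊆ P^O` under `bp`). -/
theorem BPP_subset_BPPRel (O : Oracle) : BPP ⊆ BPPRel O :=
  bp_mono (P_subset_PRel_holds O)

/-- `BPP^∅ = BPP` at the empty LANGUAGE oracle `0 = ∅`. -/
theorem BPPRel_ofLanguage_zero : BPPRel (Oracle.ofLanguage (0 : Language Bool)) = BPP :=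
  BPPRel_empty

/-! ### Machine-class axis: `W = MRung BQP` is `Hier ∨ S` -/

theorem mRung_mono {𝒬 𝒬' : Set (Language Bool)} (h : 𝒬 ⊆ 𝒬') : MRung 𝒬 → MRung 𝒬' :=
  fun hr c => let ⟨L, hL, hc⟩ := hr c; ⟨L, h hL, hc⟩

/-- Item 18127 is the rung `𝒬 = BQTime(n²)` of this axis, definitionally. -/
theorem mRung_BQTime_two_iff_languageLadderR : MRung (BQTime fun n => n ^ 2) ↔ LanguageLadderR :=
  Iff.rfl

/-- `LanguageLadderR → W`. -/
theorem languageLadderR_imp_w : LanguageLadderR → MRung BQP :=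
  fun h => mRung_mono (BQTime_pow_subset_BQP 2) (mRung_BQTime_two_iff_languageLadderR.2 h)

/-- `Hier → W` (by `BPP ⊆ BQP`, tree theorem `BPP_subset_BQP_holds`). -/
theorem hier_imp_w : Hier → MRung BQP := fun h c => by
  obtain ⟨L, hL, hc⟩ := Set.not_subset.1 (h c)
  exact ⟨L, BPP_subset_BQP_holds hL, hc⟩

/-- On-path: `S → W` (by `BPTIME(n^c) ⊆ BPP`). -/
theorem summit_imp_w : _root_.QuantumAdvantage → MRung BQP := fun ⟨L, hL, hB⟩ c =>
  ⟨L, hL, fun h => hB (BPTime_pow_subset_BPP c h)⟩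

/-- The cliff: `W → Hier ∨ S` (if `¬S` then `BQP ⊆ BPP` and the `W`-witnesses are `BPP` languages). -/
theorem w_imp_hier_or_summit : MRung BQP → Hier ∨ _root_.QuantumAdvantage := fun hW => by
  by_cases hS : _root_.QuantumAdvantage
  · exact Or.inr hS
  · refine Or.inl fun c hsub => ?_
    obtain ⟨L, hL, hc⟩ := hW c
    have hBQP : BQP ⊆ BPP := not_not.1 fun h => hS (summit_iff_not_subset.2 h)
    exact hc (hsub (hBQP hL))

/-- **`W ↔ Hier ∨ S`**: the first rung below the crux on the machine-class / quantum-exponent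
axis is exactly "the advice-free BPTIME hierarchy OR the summit". -/
theorem w_iff_hier_or_summit : MRung BQP ↔ Hier ∨ _root_.QuantumAdvantage :=
  ⟨w_imp_hier_or_summit, fun h => h.elim hier_imp_w summit_imp_w⟩

/-- The crux gives `W` (top equivalence + on-path). -/
theorem languageLadder_imp_w : LanguageLadder → MRung BQP :=
  fun h => summit_imp_w (quantumAdvantage_of_languageLadder h)

/-! ### Classical-exponent axis: every rung of 18127 is `HierAt c ∨ S` at most -/

/-- `CRung c → HierAt c ∨ S`: a proof of rung `c` of `LanguageLadderR` proves
`BPP ⊄ BPTIME(n^c)` or the summit. -/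
theorem cRung_imp (c : ℕ) : CRung c → HierAt c ∨ _root_.QuantumAdvantage := fun ⟨L, hL, hc⟩ => by
  by_cases hS : _root_.QuantumAdvantage
  · exact Or.inr hS
  · refine Or.inl fun hsub => ?_
    have hBQP : BQP ⊆ BPP := not_not.1 fun h => hS (summit_iff_not_subset.2 h)
    exact hc (hsub (hBQP (BQTime_pow_subset_BQP 2 hL)))

theorem languageLadderR_iff_forall_cRung : LanguageLadderR ↔ ∀ c, CRung c :=
  Iff.rfl

/-! ### Oracle axis: compiled floor, on-path, cap -/

/-- FLOOR (F3 witness): the rung `𝒞 = univ` is the tree theorem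
`exists_oracle_BQPRel_not_subset_BPPRel_holds` (Bernstein–Vazirani §8.4 / Raz–Tal Cor. 1.5). -/
theorem oracleRung_univ : OracleRung Set.univ := by
  simpa [OracleRung, exists_oracle_BQPRel_not_subset_BPPRel] using
    exists_oracle_BQPRel_not_subset_BPPRel_holds

theorem oracleRung_mono {𝒞 𝒞' : Set (Language Bool)} (h : 𝒞 ⊆ 𝒞') : OracleRung 𝒞 → OracleRung 𝒞' :=
  fun ⟨A, hA, hn⟩ => ⟨A, h hA, hn⟩

/-- Every rung gives back the floor statement. -/
theorem oracleRung_imp_floor (𝒞 : Set (Language Bool)) :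
    OracleRung 𝒞 → exists_oracle_BQPRel_not_subset_BPPRel :=
  fun ⟨A, _, hn⟩ => ⟨A, hn⟩

/-- On-path: `S → OracleRung 𝒞` for every class containing the empty language
(`BQP ⊆ BQP^0`, `BPP^0 = BPP`). -/
theorem summit_imp_oracleRung {𝒞 : Set (Language Bool)} (h0 : (0 : Language Bool) ∈ 𝒞) :
    _root_.QuantumAdvantage → OracleRung 𝒞 := fun hS =>
  ⟨0, h0, fun hsub => (summit_iff_not_subset.1 hS) fun L hL => by
    have h := hsub (BQP_subset_BQPRel 0 hL)
    rwa [BPPRel_ofLanguage_zero] at h⟩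

/-- CAP: under the lowness of `BPP` for `BQP` (Bennett–Bernstein–Brassard–Vazirani 1997,
Cor. 4.15, `BQP^BQP = BQP`; taken as a HYPOTHESIS here), a rung whose oracle class sits inside
`BPP` is the summit. Hence `OracleRung EXP → (EXP ⊆ BPP → S)`: any proof of the rung `𝒞 = EXP`
proves `EXP ⊄ BPP` or the summit. -/
theorem oracleRung_cap {𝒞 : Set (Language Bool)} (hlow : ∀ A ∈ BPP, BQPRel A ⊆ BQP)
    (h𝒞 : 𝒞 ⊆ BPP) : OracleRung 𝒞 → _root_.QuantumAdvantage := fun ⟨A, hA, hn⟩ =>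
  summit_iff_not_subset.2 fun hBQP =>
    hn (((hlow A (h𝒞 hA)).trans hBQP).trans (BPP_subset_BPPRel _))

/-- The same cap, stated for `EXP`. -/
theorem oracleRung_EXP_cap (hlow : ∀ A ∈ BPP, BQPRel A ⊆ BQP) :
    OracleRung EXP → EXP ⊆ BPP → _root_.QuantumAdvantage :=
  fun h hE => oracleRung_cap hlow hE h

/-! ### Query-budget axis: a cliff (`t = 0` is the summit) -/

theorem queryRung_mono {t t' : ℕ → ℕ} (h : t ≤ t') : QueryRung t → QueryRung t' :=
  fun ⟨A, hA⟩ => ⟨A, fun hsub => hA ((BQPRelQueries_mono h).trans hsub)⟩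

theorem queryRung_imp_floor (t : ℕ → ℕ) : QueryRung t → exists_oracle_BQPRel_not_subset_BPPRel :=
  fun ⟨A, hA⟩ => ⟨A, fun hsub => hA ((BQPRelQueries_subset_BQPRel A t).trans hsub)⟩

/-- On-path: `S → QueryRung t` for every budget. -/
theorem summit_imp_queryRung (t : ℕ → ℕ) : _root_.QuantumAdvantage → QueryRung t := fun hS =>
  ⟨0, fun hsub => (summit_iff_not_subset.1 hS) fun L hL => by
    have h := hsub (BQP_subset_BQPRelQueries 0 t hL)
    rwa [BPPRel_ofLanguage_zero] at h⟩

/-- **The cliff**: zero queries is the summit (`BQPRelQueries A 0 = BQP`, `BPP ⊆ BPP^A`). -/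
theorem queryRung_zero_iff : QueryRung 0 ↔ _root_.QuantumAdvantage := by
  refine ⟨?_, summit_imp_queryRung 0⟩
  rintro ⟨A, hA⟩
  rw [BQPRelQueries_zero] at hA
  exact summit_iff_not_subset.2 fun h => hA (h.trans (BPP_subset_BPPRel _))

end Summit.QuantumAdvantage.QuantumAdvantage.Cruxes.LanguageLadder.LadderCliffs
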